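import Literature.NumberTheory.EllipticCurves.Tian2014.ClassFiveFamilyDescentProofs
import Literature.NumberTheory.EllipticCurves.CongruentNumberOddMonskySelmerExact
import Literature.NumberTheory.EllipticCurves.CongruentNumberSelmerEightShaTwo
import Literature.NumberTheory.QuadraticFields.RedeiReichardtFourRank
import HarnessLib

/-!
# Monsky 1990, Remark (3), the PRINTED EXAMPLE FAMILY — `N = p₁⋯p_m` with `m` ODD, every `pᵢ ≡ 5 (mod 8)`, no two
# quadratic residues of one another, `N* = 2`: «`S̄ = ℤ/2`» (`#Sel⁽²⁾(E_N/ℚ) = 8`) for EVERY such `N`, in the kernel,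
# and Monsky's «we suspect that `S_N` has infinite order (so that `E^{(N)}_ℚ` again has rank `1`)» as a theorem of the
# tree relative to Li–Liu–Tian 2024 Thm. 1.2 (the family is a sub-family of Tian's class-`5` odd-graph family)

Monsky, Math. Z. 204 (1990), p. 67 Remark (3), verbatim: «`S̄` and `S̄*` tend to grow in size with the number of prime
factors of `N` and `N*`. But even when `D` has many prime factors it can happen that `S̄ = ℤ/2` and `S̄* = (0)`. (This
happens, for example, when `N` is the product of an odd number of primes, each of which is `≡ 5 (8)` and no two of
which are quadratic residues of one another, while `N* = 2`). Suppose now that `S̄ = ℤ/2`, `S̄* = (0)` and that `D` has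
`ℓ ≧ 2` prime factors. We suspect that `S_N` has infinite order (so that `E^{(N)}_ℚ` again has rank `1`) and that `S_N`
is divisible by `2^{ℓ−2}`, but not by `2^{ℓ−1}`, in `Λ_N/T`.» (`S̄ = Sel⁽²⁾(E^{(N)}/ℚ)/E^{(N)}(ℚ)[2]`, Remark (1).)

THIS FILE (cell `bsd-monsky`, prover-A; HONEST FRAMING: nothing booked, no mark moved, no new named fact):
* `legendreMatrix_mulVec_eq_zero_of_pairwise_nonresidue` — for an ODD number of primes, pairwise non-residues, Monsky's
  symbol matrix `A` is `J + I` over `𝔽₂` (diagonal = row sum = `m − 1 ≡ 0`), whose kernel is `{0, 1}`: Feng's «odd graph»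
  condition `hG` of the tree's class-`5` odd-graph family holds.
* `monskySelmerRankOdd_eq_one_of_remarkThree`, `card_selmerGroup_two_eq_eight_of_remarkThree` — **`s(N) = 1`, i.e.
  `#Sel⁽²⁾(E_N/ℚ) = 8` («`S̄ = ℤ/2`»), for every member**, UNCONDITIONALLY (Tian's (5.1) on the odd-graph family in
  Monsky's currency + Monsky's odd formula with equality); `#Sel⁽²⁾(E_2/ℚ) = 4` («`S̄* = (0)`») is the tree's
  `card_selmerGroup_two_congruentNumberCurve_two_mul_prime`-type count at `k = 0` (not restated).
* `mordellWeilRank_le_one_of_remarkThree`, `isCongruentNumber_iff_primaryComponent_sha_two_eq_bot_of_remarkThree` —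
  `rk E_N(ℚ) ≤ 1` and «`N` congruent ⟺ `Ш(E_N)[2^∞] = 0`», unconditionally.
* `bsd_congruentNumberCurve_of_remarkThree`, `forall_bsdp_congruentNumberCurve_of_remarkThree` — **relative to the
  displayed Li–Liu–Tian 2024 Thm. 1.2 ALONE** (Rédei–Reichardt is a tree theorem): `rk E_N(ℚ) = 1 = ord_{s=1} L(E_N, s)`,
  `BSDTriple`, and `BSD(E_N, ℓ)` for EVERY prime `ℓ` — Monsky's «infinite order … rank `1`» on his own example family,
  with the full BSD formula on top. The `2`-divisibility clause (`S_N ∈ 2^{ℓ−2}Λ_N ∖ 2^{ℓ−1}Λ_N + T`) concerns Monsky's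
  mock Heegner point, not a tree object, and is NOT touched.

References: [Monsky1990MockHeegner] Remark (3) (p. 67), Remark (1) (pp. 66–67); [Tian2014] Thm. 1.3, (5.1) (arXiv p. 29);
[LiLiuTian2024] Thm. 1.2; [HeathBrown1994SelmerCongruentII] Appendix (Monsky) p. 39; [LiMa2008] Thm. 0.4; [SilvermanAEC2009] Thm. X.4.2.
-/

noncomputable section

open scoped Classical

open Matrix Finset WeierstrassCurve Literature.NumberTheory.EllipticCurves
  Literature.NumberTheory.EllipticCurves.HeathBrown1994
  Literature.NumberTheory.EllipticCurves.Tian2014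
  Literature.NumberTheory.EllipticCurves.LiLiuTian2024
  Literature.NumberTheory.EllipticCurves.SelmerEightShaTwo
  Literature.NumberTheory.QuadraticFields.RedeiReichardt

set_option autoImplicit false

namespace Literature.NumberTheory.EllipticCurves.Monsky1990

variable {k : ℕ} (p : Fin (k + 1) → ℕ)

/-! ## §1 The symbol matrix of a pairwise non-residue family is `J + I`; its kernel is `{0, 1}` -/

/-- **Monsky's symbol matrix on a pairwise non-residue family with an ODD number of primes is `J + I`** (`J` the all-ones
matrix): off the diagonal every additive symbol is `1`; on the diagonal the row sum is `m − 1 = k ≡ 0 (mod 2)`.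
[cite: HeathBrown1994SelmerCongruentII, Appendix (Monsky), typescript p. 39 L13–L26] [cite: Monsky1990MockHeegner, Remark (3) (p. 67)] -/
theorem legendreMatrix_eq_of_pairwise_nonresidue (hnr : ∀ i j, i ≠ j → jacobiSym (p j) (p i) = -1) (hk : Even k) :
    legendreMatrix p = Matrix.of (fun _ _ => (1 : ZMod 2)) + 1 := by
  ext i j
  simp only [legendreMatrix, Matrix.of_apply, Matrix.add_apply, Matrix.one_apply]
  by_cases hij : i = j
  · subst hij
    rw [if_pos rfl, if_pos rfl]
    have hsum : ∑ l ∈ univ.erase i, addLegendreSym (p l) (p i) = ∑ l ∈ univ.erase i, (1 : ZMod 2) :=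
      Finset.sum_congr rfl fun l hl => addLegendreSym_of_eq_neg_one (hnr i l (Finset.ne_of_mem_erase hl).symm)
    rw [hsum, Finset.sum_const, Finset.card_erase_of_mem (Finset.mem_univ i), Finset.card_univ, Fintype.card_fin,
      Nat.add_sub_cancel, nsmul_eq_mul, mul_one]
    obtain ⟨m, rfl⟩ := hk
    push_cast
    have h2 : (2 : ZMod 2) = 0 := rfl
    rw [← two_mul, h2, zero_mul]
    rfl
  · rw [if_neg hij, if_neg hij, addLegendreSym_of_eq_neg_one (hnr i j hij), add_zero]

/-- **The kernel of `J + I` over `𝔽₂` (odd size) is `{0, 1}`**: `(J + I)v = 0` forces every coordinate to equal the sum of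
all coordinates. This is Feng's odd-graph condition on the family. [cite: Monsky1990MockHeegner, Remark (3) (p. 67)]
[cite: Tian2014, (5.1) (arXiv p. 29)] -/
theorem legendreMatrix_mulVec_eq_zero_of_pairwise_nonresidue (hnr : ∀ i j, i ≠ j → jacobiSym (p j) (p i) = -1)
    (hk : Even k) : ∀ v, legendreMatrix p *ᵥ v = 0 → v = 0 ∨ v = fun _ => 1 := by
  intro v hv
  rw [legendreMatrix_eq_of_pairwise_nonresidue p hnr hk, Matrix.add_mulVec, Matrix.one_mulVec] at hv
  have hJ : ∀ i, ((Matrix.of (fun _ _ => (1 : ZMod 2)) : Matrix (Fin (k + 1)) (Fin (k + 1)) (ZMod 2)) *ᵥ v) i =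
      ∑ j, v j := by
    intro i
    simp only [Matrix.mulVec, dotProduct, Matrix.of_apply, one_mul]
  have hcoord : ∀ i, v i = ∑ j, v j := by
    intro i
    have hi := congr_fun hv i
    rw [Pi.add_apply, hJ, Pi.zero_apply] at hi
    have key : ∀ a b : ZMod 2, a + b = 0 → b = a := by decide
    exact key _ _ hi
  have hcases : ∀ x : ZMod 2, x = 0 ∨ x = 1 := by decide
  rcases hcases (∑ j, v j) with h0 | h1
  · left
    funext i
    rw [hcoord i, h0]
    rfl
  · right
    funext i
    rw [hcoord i, h1]

/-! ## §2 The family is a sub-family of Tian's class-`5` odd-graph family: `s(N) = 1`, `#Sel⁽²⁾(E_N/ℚ) = 8` -/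

/-- An odd number of primes `≡ 5 (mod 8)` has product `≡ 5 (mod 8)`. [cite: HardyWright2008, §17.8] -/
theorem prod_mod_eight_eq_five_of_all_five (h5 : ∀ i, p i % 8 = 5) (hk : Even k) : (∏ i, p i) % 8 = 5 := by
  have h4 : ∀ i, p i % 4 = 1 := fun i => by have := h5 i; omega
  rw [prod_mod_eight_eq_ite p h4 univ]
  have hfil : (univ.filter fun i => p i % 8 = 5) = (univ : Finset (Fin (k + 1))) :=
    Finset.filter_true_of_mem fun i _ => h5 i
  rw [hfil, Finset.card_univ, Fintype.card_fin, if_neg]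
  obtain ⟨m, rfl⟩ := hk
  rw [Nat.not_even_iff_odd]
  exact ⟨m, by ring⟩

/-- **`s(N) = 1` on Monsky's Remark (3) example family** (an odd number of primes `≡ 5 (mod 8)`, pairwise non-residues):
the family sits inside Tian's class-`5` odd-graph family (`monskySelmerRankOdd_caseFive`). UNCONDITIONAL.
[cite: Monsky1990MockHeegner, Remark (3) (p. 67)] [cite: Tian2014, (5.1) (arXiv p. 29)]
[cite: HeathBrown1994SelmerCongruentII, Appendix (Monsky), typescript p. 39 L33] -/
theorem monskySelmerRankOdd_eq_one_of_remarkThree (h5 : ∀ i, p i % 8 = 5)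
    (hnr : ∀ i j, i ≠ j → jacobiSym (p j) (p i) = -1) (hk : Even k) : monskySelmerRankOdd p = 1 :=
  monskySelmerRankOdd_caseFive p (fun i => by have := h5 i; omega) (prod_mod_eight_eq_five_of_all_five p h5 hk)
    (legendreMatrix_mulVec_eq_zero_of_pairwise_nonresidue p hnr hk)

/-- **MONSKY'S REMARK (3) EXAMPLE, THE SELMER CLAUSE, IN THE KERNEL: `#Sel⁽²⁾(E_N/ℚ) = 8` («`S̄ = ℤ/2`») for every
`N = p₁⋯p_m`, `m` odd, all `pᵢ ≡ 5 (mod 8)`, no two residues of one another.** UNCONDITIONAL (Monsky's odd formula with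
equality). [cite: Monsky1990MockHeegner, Remark (3) (p. 67)] [cite: HeathBrown1994SelmerCongruentII, Appendix (Monsky), typescript p. 39 L10–L33] -/
theorem card_selmerGroup_two_eq_eight_of_remarkThree (hp : ∀ i, (p i).Prime) (hinj : Function.Injective p)
    (h5 : ∀ i, p i % 8 = 5) (hnr : ∀ i j, i ≠ j → jacobiSym (p j) (p i) = -1) (hk : Even k) :
    Nat.card ((congruentNumberCurve (∏ i, p i)).selmerGroup 2) = 8 := by
  have hp2 : ∀ i, p i ≠ 2 := fun i => by have := h5 i; omega
  rw [CongruentNumberOddMonskySelmerExact.card_selmerGroup_two_eq_pow hp hp2 hinj,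
    monskySelmerRankOdd_eq_one_of_remarkThree p h5 hnr hk]
  norm_num

/-- **`rk E_N(ℚ) ≤ 1` on the Remark (3) example family**, unconditionally («the rank is bounded by `dim S̄ = 1`»).
[cite: Monsky1990MockHeegner, Remark (2)–(3) (p. 67)] [cite: SilvermanAEC2009, Thm. X.4.2] -/
theorem mordellWeilRank_le_one_of_remarkThree (hp : ∀ i, (p i).Prime) (hinj : Function.Injective p)
    (h5 : ∀ i, p i % 8 = 5) (hnr : ∀ i j, i ≠ j → jacobiSym (p j) (p i) = -1) (hk : Even k) :
    haveI := isElliptic_congruentNumberCurve (Squarefree.ne_zero (squarefree_prod_of_injective p hp hinj))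
    (congruentNumberCurve (∏ i, p i)).mordellWeilRank ≤ 1 := by
  haveI := isElliptic_congruentNumberCurve (Squarefree.ne_zero (squarefree_prod_of_injective p hp hinj))
  exact (natCard_sha_two_eq_pow_sub (Squarefree.ne_zero (squarefree_prod_of_injective p hp hinj)) (s := 1)
    (by rw [card_selmerGroup_two_eq_eight_of_remarkThree p hp hinj h5 hnr hk]; norm_num)).1

/-- **On the Remark (3) example family: `N` congruent ⟺ `Ш(E_N)[2^∞] = 0`**, unconditionally.
[cite: Monsky1990MockHeegner, Remark (3) (p. 67)] [cite: TopYui2008Congruent, Prop. 3.3 (i) ⟺ (iv)] [cite: SilvermanAEC2009, Thm. X.4.2] -/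
theorem isCongruentNumber_iff_primaryComponent_sha_two_eq_bot_of_remarkThree (hp : ∀ i, (p i).Prime)
    (hinj : Function.Injective p) (h5 : ∀ i, p i % 8 = 5) (hnr : ∀ i j, i ≠ j → jacobiSym (p j) (p i) = -1)
    (hk : Even k) :
    haveI := isElliptic_congruentNumberCurve (Squarefree.ne_zero (squarefree_prod_of_injective p hp hinj))
    IsCongruentNumber (∏ i, p i) ↔ AddCommGroup.primaryComponent (congruentNumberCurve (∏ i, p i)).sha 2 = ⊥ :=
  isCongruentNumber_iff_primaryComponent_sha_two_eq_bot_of_card_selmerGroup_two_eq_eight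
    (Squarefree.ne_zero (squarefree_prod_of_injective p hp hinj))
    (card_selmerGroup_two_eq_eight_of_remarkThree p hp hinj h5 hnr hk)

/-! ## §3 Monsky's «we suspect that `S_N` has infinite order (rank `1`)» on his example family, relative to Li–Liu–Tian 2024 -/

/-- **Rank `1 = ord_{s=1} L(E_N, s)` and `BSDTriple` on Monsky's Remark (3) example family, relative to the displayed
Li–Liu–Tian 2024 Thm. 1.2 ALONE** (Rédei–Reichardt is a tree theorem; the family is a sub-family of the class-`5`
odd-graph family, `bsd_congruentNumberCurve_caseFive`). Monsky's «`E^{(N)}_ℚ` again has rank `1`» on the family he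
printed as his example. CONDITIONAL on `hLLT`; nothing asserted. [cite: Monsky1990MockHeegner, Remark (3) (p. 67)]
[cite: LiLiuTian2024, Thm. 1.2] [cite: LiMa2008, Thm. 0.4 (p. 280)] -/
theorem bsd_congruentNumberCurve_of_remarkThree (hLLT : thm12_bsd_congruentNumberCurve) (hp : ∀ i, (p i).Prime)
    (hinj : Function.Injective p) (h5 : ∀ i, p i % 8 = 5) (hnr : ∀ i j, i ≠ j → jacobiSym (p j) (p i) = -1)
    (hk : Even k) {n : ℕ} (hn : ∏ i, p i = n) :
    haveI := isElliptic_congruentNumberCurve (Squarefree.ne_zero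
      (thm12_hypotheses_caseFive p hp hinj (fun i => by have := h5 i; omega)
        (prod_mod_eight_eq_five_of_all_five p h5 hk) hn).1)
    haveI := isGloballyMinimal_congruentNumberCurve
      (thm12_hypotheses_caseFive p hp hinj (fun i => by have := h5 i; omega)
        (prod_mod_eight_eq_five_of_all_five p h5 hk) hn).1
    (congruentNumberCurve n).mordellWeilRank = 1 ∧ (congruentNumberCurve n).analyticRank = 1 ∧
      (congruentNumberCurve n).BSDTriple :=
  bsd_congruentNumberCurve_caseFive p redeiReichardt_fourTwoCard_classGroup_holds hLLT hp hinj
    (fun i => by have := h5 i; omega) (prod_mod_eight_eq_five_of_all_five p h5 hk)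
    (legendreMatrix_mulVec_eq_zero_of_pairwise_nonresidue p hnr hk) hn

/-- **`BSD(E_N, ℓ)` for EVERY prime `ℓ` (including `2`) on Monsky's Remark (3) example family, relative to Li–Liu–Tian
2024 Thm. 1.2 alone.** CONDITIONAL on `hLLT`; nothing asserted. [cite: Monsky1990MockHeegner, Remark (3) (p. 67)]
[cite: LiLiuTian2024, Thm. 1.2] [cite: Miller2011LMS, §1 and Def. 1.1] -/
theorem forall_bsdp_congruentNumberCurve_of_remarkThree (hLLT : thm12_bsd_congruentNumberCurve) (hp : ∀ i, (p i).Prime)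
    (hinj : Function.Injective p) (h5 : ∀ i, p i % 8 = 5) (hnr : ∀ i j, i ≠ j → jacobiSym (p j) (p i) = -1)
    (hk : Even k) {n : ℕ} (hn : ∏ i, p i = n) (ℓ : ℕ) (hℓ : ℓ.Prime) :
    haveI := isElliptic_congruentNumberCurve (Squarefree.ne_zero
      (thm12_hypotheses_caseFive p hp hinj (fun i => by have := h5 i; omega)
        (prod_mod_eight_eq_five_of_all_five p h5 hk) hn).1)
    haveI := isGloballyMinimal_congruentNumberCurve
      (thm12_hypotheses_caseFive p hp hinj (fun i => by have := h5 i; omega)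
        (prod_mod_eight_eq_five_of_all_five p h5 hk) hn).1
    BSDp (congruentNumberCurve n) ℓ :=
  forall_bsdp_congruentNumberCurve_caseFive p redeiReichardt_fourTwoCard_classGroup_holds hLLT hp hinj
    (fun i => by have := h5 i; omega) (prod_mod_eight_eq_five_of_all_five p h5 hk)
    (legendreMatrix_mulVec_eq_zero_of_pairwise_nonresidue p hnr hk) hn ℓ hℓ

end Literature.NumberTheory.EllipticCurves.Monsky1990

end
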